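import Summits.Ventures.CertifiedManyBodySolver.Transport.PauliMarkovMatrixBody
import HarnessLib

/-!
# Ventures/CertifiedManyBodySolver — Transport/PauliMarkovMatrixSigma.lean

HONEST FRAMING: first certified bounds; not a superconductivity verdict; every number certified or labelled float.

**LEMMA PMP with op-02's integrand verbatim (op-02 `HOME/op/PM-2D.md` §7.4).** With the closed-form support
function of the PMP body (`Transport/PauliMarkovMatrixBody.lean`: `re_trace_mul_le_sigmaTwo`) applied to the
Hermitian part `Y_h = (Y + Yᴴ)/2` (`hermPart`; `Re tr(Y M) = Re tr(Y_h M)` for Hermitian `M`):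

  `σ_{C(ν)}(Y) := σ₂(Re tr(C(ν) Y_h), Re(det C(ν) det Y_h))` (`pmpSigma`),  `Re tr(Y M) ≤ σ_{C(ν)}(Y)` on
  `0 ⪯ M ⪯ C(ν)`, `ν ∈ [0, 1]` (`re_trace_mul_le_pmpSigma`),

and, for every translation-invariant `ω : InfVolFermionState d`, spins `σ ≠ τ`, finite `Λ : S → M₂(ℂ)`:

  **`Σ_{r∈S} Re tr(Λ_r G_ω(r)) ≤ h(Λ) := (2π)^{-d} ∫_{(0,2π]^d} σ_{C(ν)}(Λ̂(k)) dk`**,  `ν = ω(n_{0τ}) ∈ [0, 1]`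

(`pmpValue`, `InfVolFermionState.IsTranslationInvariant.pauliMarkovMatrix_sigma` — the PMP row inequality
`Σ_r tr(Λ_r^* M̂(r)) ≤ h(Λ)` of PM-2D.md §7.4 with its integrand `σ_C(Λ(k))`, up to the `r ↦ −r` relabelling),
the operator form `re_expect_pmpOp_le_pmpValue`, and the certificate slack forms
`re_expect_pmpSigmaSlack_nonneg` / `re_expect_sub_pmpSigmaSlack_le` (rows with multipliers `κ_i ≥ 0` and the
reader's validated-quadrature / Arb bound `h(Λ_i) ≤ B_i` as the hypothesis `hB`, moved into the objective).

No physical notion is defined (abbreviations `hermPart`, `pmpSigma`, `pmpValue`), no named fact, no sorry.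

References: op-02 PM-2D.md §7.4–7.5 (σ_C, validated quadrature of `h(Λ)`, row grammar `…_pmp<K>`).
-/

noncomputable section

namespace Summit.Ventures.CertifiedManyBodySolver.Transport

open Matrix Finset MeasureTheory
open Literature.Probability.LatticeModels
open Literature.MathematicalPhysics.QuantumLattice HubbardWave0
open scoped ComplexOrder Real

variable {d : ℕ}

/-! ### §1. The support function `σ_{C(ν)}` and the PMP row with op-02's integrand -/

section Sigma

variable {n : Type*}

/-- The Hermitian part `Y_h = (Y + Yᴴ)/2`. -/
def hermPart (Y : Matrix n n ℂ) : Matrix n n ℂ := (2⁻¹ : ℂ) • (Y + Yᴴ)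

/-- `Y_h` is Hermitian. -/
theorem hermPart_isHermitian (Y : Matrix n n ℂ) : (hermPart Y).IsHermitian := by
  unfold hermPart
  refine Matrix.IsHermitian.ext fun i j => ?_
  simp only [Matrix.smul_apply, Matrix.add_apply, Matrix.conjTranspose_apply, smul_eq_mul, star_mul',
    star_add, star_star]
  rw [add_comm (star (Y j i))]
  congr 1
  simp

/-- `Y_h` depends continuously on `Y`. -/
theorem continuous_hermPart : Continuous (hermPart (n := n)) := by
  have h1 : Continuous fun Y : Matrix n n ℂ => Yᴴ := continuous_id.matrix_conjTranspose
  unfold hermPart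
  exact (continuous_id.add h1).const_smul (2⁻¹ : ℂ)

variable [Fintype n]

/-- `Re tr(Y_h M) = Re tr(Y M)` for Hermitian `M`. -/
theorem re_trace_hermPart_mul (Y : Matrix n n ℂ) {M : Matrix n n ℂ} (hM : M.IsHermitian) :
    ((hermPart Y * M).trace).re = ((Y * M).trace).re := by
  have h2 : (Yᴴ * M).trace = star (Y * M).trace := by
    rw [← Matrix.trace_conjTranspose, Matrix.conjTranspose_mul, hM.eq, Matrix.trace_mul_comm]
  rw [hermPart, Matrix.smul_mul, Matrix.add_mul, Matrix.trace_smul, Matrix.trace_add, h2, smul_eq_mul]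
  simp only [Complex.mul_re, Complex.add_re, Complex.add_im, Complex.star_def, Complex.conj_re,
    Complex.conj_im, Complex.inv_re, Complex.inv_im]
  norm_num
  ring

/-- **op-02's support function in closed form**: `σ_{C(ν)}(Y) = σ₂(Re tr(C(ν) Y_h), Re(det C(ν) det Y_h))`
(`= (μ₁)₊ + (μ₂)₊`, `μ_{1,2}` the eigenvalues of `C^{1/2} Y_h C^{1/2}`; PM-2D.md §7.4). -/
def pmpSigma (ν : ℝ) (Y : Matrix (Fin 2) (Fin 2) ℂ) : ℝ :=
  sigmaTwo ((pmpConst ν * hermPart Y).trace.re) (((pmpConst ν).det * (hermPart Y).det).re)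

/-- `det C(ν) = ν − ν²`. -/
theorem det_pmpConst (ν : ℝ) : (pmpConst ν).det = ((ν - ν ^ 2 : ℝ) : ℂ) := by
  rw [pmpConst, Matrix.det_fin_two_of]
  push_cast
  ring

/-- **`Re tr(Y M) ≤ σ_{C(ν)}(Y)` on the body `0 ⪯ M ⪯ C(ν)`** (`ν ∈ [0, 1]`, any `2 × 2` matrix `Y`). -/
theorem re_trace_mul_le_pmpSigma {ν : ℝ} (hν0 : 0 ≤ ν) (hν1 : ν ≤ 1) {M : Matrix (Fin 2) (Fin 2) ℂ}
    (hM : PMPFeasible ν M) (Y : Matrix (Fin 2) (Fin 2) ℂ) : ((Y * M).trace).re ≤ pmpSigma ν Y := by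
  rw [← re_trace_hermPart_mul Y hM.1.1]
  exact re_trace_mul_le_sigmaTwo hν0 hν1 (hermPart_isHermitian Y) hM

/-- `σ_{C(ν)}` is continuous in `Y`. -/
theorem continuous_pmpSigma (ν : ℝ) : Continuous (pmpSigma ν) := by
  unfold pmpSigma
  have h1 : Continuous fun Y : Matrix (Fin 2) (Fin 2) ℂ => ((pmpConst ν * hermPart Y).trace).re :=
    Complex.continuous_re.comp ((continuous_const.mul continuous_hermPart).matrix_trace)
  have h2 : Continuous fun Y : Matrix (Fin 2) (Fin 2) ℂ => (((pmpConst ν).det * (hermPart Y).det)).re :=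
    Complex.continuous_re.comp (continuous_const.mul continuous_hermPart.matrix_det)
  exact continuous_sigmaTwo.comp (h1.prodMk h2)

/-- **op-02's rhs `h(Λ) = (2π)^{-d} ∫_{(0,2π]^d} σ_{C(ν)}(Λ̂(k)) dk`** (an exact Lebesgue integral; the
reader's validated quadrature / Arb leg bounds it from above). -/
def pmpValue (ν : ℝ) (S : Finset (Site d)) (Lam : Site d → Matrix (Fin 2) (Fin 2) ℂ) : ℝ :=
  ((2 * π) ^ d)⁻¹ * ∫ k in torusBox d, pmpSigma ν (matrixSymbol S Lam k)

/-- The integrand `k ↦ σ_{C(ν)}(Λ̂(k))` is continuous, hence integrable on the box. -/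
theorem integrableOn_pmpSigma_matrixSymbol (ν : ℝ) (S : Finset (Site d))
    (Lam : Site d → Matrix (Fin 2) (Fin 2) ℂ) :
    IntegrableOn (fun k => pmpSigma ν (matrixSymbol S Lam k)) (torusBox d) :=
  integrableOn_torusBox_of_continuous ((continuous_pmpSigma ν).comp (continuous_matrixSymbol S Lam))

variable (ω : InfVolFermionState d) (σ τ : Fin 2)

/-- The spin density lies in `[0, 1]` (positivity and the Pauli bound). -/
theorem spinDensity_mem_Icc : 0 ≤ spinDensity ω τ ∧ spinDensity ω τ ≤ 1 := by
  refine ⟨?_, (Complex.re_le_norm _).trans (ω.norm_twoPoint_self_le_one τ 0)⟩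
  rw [spinDensity, ← ω.expect_creation_mul_annihilation τ (Finset.mem_singleton_self (0 : Site d))
    (Finset.mem_singleton_self (0 : Site d))]
  exact (Complex.nonneg_iff.1 (ω.expect_nonneg _ _)).1

/-- **LEMMA PMP with op-02's integrand (PM-2D.md §7.4).** For a translation-invariant infinite-volume
lattice fermion state `ω`, spins `σ ≠ τ`, and every finite coefficient family `Λ : S → M₂(ℂ)`:
`Σ_{r∈S} Re tr(Λ_r G_ω(r)) ≤ h(Λ) = (2π)^{-d} ∫_{(0,2π]^d} σ_{C(ν)}(Λ̂(k)) dk`, `ν = ω(n_{0τ})`. -/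
theorem _root_.Literature.MathematicalPhysics.QuantumLattice.InfVolFermionState.IsTranslationInvariant.pauliMarkovMatrix_sigma
    (hω : ω.IsTranslationInvariant) (hστ : σ ≠ τ) (S : Finset (Site d))
    (Lam : Site d → Matrix (Fin 2) (Fin 2) ℂ) :
    ∑ r ∈ S, ((Lam r * letterTwoPoint ω σ τ r).trace).re ≤ pmpValue (spinDensity ω τ) S Lam :=
  hω.pauliMarkovMatrix ω σ τ hστ S Lam _ (integrableOn_pmpSigma_matrixSymbol _ S Lam) fun _ _ _ hM =>
    re_trace_mul_le_pmpSigma (spinDensity_mem_Icc ω τ).1 (spinDensity_mem_Icc ω τ).2 hM _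

/-- **Operator form**: `Re ω(O_Λ) ≤ h(Λ)` on any region `Λ ∋ 0`, `Λ ⊇ S`. -/
theorem re_expect_pmpOp_le_pmpValue (hω : ω.IsTranslationInvariant) (hστ : σ ≠ τ) (S : Finset (Site d))
    (Lam : Site d → Matrix (Fin 2) (Fin 2) ℂ) (Λ : Finset (Site d)) (h0 : (0 : Site d) ∈ Λ)
    (hmem : ∀ r ∈ S, r ∈ Λ) :
    (ω.expect Λ (pmpOp S Lam σ τ Λ h0 hmem)).re ≤ pmpValue (spinDensity ω τ) S Lam := by
  rw [expect_pmpOp, Complex.re_sum]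
  exact hω.pauliMarkovMatrix_sigma ω σ τ hστ S Lam

/-- **Slack form for certificates** (PMP rows `(σ_i, τ_i, S_i, Λ^{(i)})`, `κ_i ≥ 0`, `h(Λ^{(i)}) ≤ B_i`):
`0 ≤ Re ω(Σ_i κ_i (B_i 𝟙 − O_{Λ^{(i)}}))` in every translation-invariant state. -/
theorem re_expect_pmpSigmaSlack_nonneg (hω : ω.IsTranslationInvariant) {Λ : Finset (Site d)}
    (h0 : (0 : Site d) ∈ Λ) {ι : Type*} (s : Finset ι) (σ τ : ι → Fin 2) (hστ : ∀ i ∈ s, σ i ≠ τ i)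
    (S : ι → Finset (Site d)) (Lam : ι → Site d → Matrix (Fin 2) (Fin 2) ℂ) (hmem : ∀ i, ∀ r ∈ S i, r ∈ Λ)
    (κ B : ι → ℝ) (hκ : ∀ i ∈ s, 0 ≤ κ i)
    (hB : ∀ i ∈ s, pmpValue (spinDensity ω (τ i)) (S i) (Lam i) ≤ B i) :
    0 ≤ (ω.expect Λ (∑ i ∈ s, ((κ i : ℝ) : ℂ) •
      (((B i : ℝ) : ℂ) • (1 : FermionOp Λ) - pmpOp (S i) (Lam i) (σ i) (τ i) Λ h0 (hmem i)))).re := by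
  rw [map_sum, Complex.re_sum]
  refine Finset.sum_nonneg fun i hi => ?_
  rw [map_smul, smul_eq_mul, Complex.re_ofReal_mul, map_sub, map_smul, ω.expect_one, smul_eq_mul, mul_one,
    Complex.sub_re, Complex.ofReal_re]
  refine mul_nonneg (hκ i hi) (sub_nonneg.2 ?_)
  exact (re_expect_pmpOp_le_pmpValue ω (σ i) (τ i) hω (hστ i hi) (S i) (Lam i) Λ h0 (hmem i)).trans (hB i hi)

/-- The same in difference form: `Re ω(X − Σ_i κ_i (B_i 𝟙 − O_{Λ^{(i)}})) ≤ Re ω(X)`. -/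
theorem re_expect_sub_pmpSigmaSlack_le (hω : ω.IsTranslationInvariant) {Λ : Finset (Site d)}
    (h0 : (0 : Site d) ∈ Λ) {ι : Type*} (s : Finset ι) (σ τ : ι → Fin 2) (hστ : ∀ i ∈ s, σ i ≠ τ i)
    (S : ι → Finset (Site d)) (Lam : ι → Site d → Matrix (Fin 2) (Fin 2) ℂ) (hmem : ∀ i, ∀ r ∈ S i, r ∈ Λ)
    (κ B : ι → ℝ) (hκ : ∀ i ∈ s, 0 ≤ κ i)
    (hB : ∀ i ∈ s, pmpValue (spinDensity ω (τ i)) (S i) (Lam i) ≤ B i) (X : FermionOp Λ) :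
    (ω.expect Λ (X - ∑ i ∈ s, ((κ i : ℝ) : ℂ) •
      (((B i : ℝ) : ℂ) • (1 : FermionOp Λ) - pmpOp (S i) (Lam i) (σ i) (τ i) Λ h0 (hmem i)))).re ≤
      (ω.expect Λ X).re := by
  rw [map_sub, Complex.sub_re]
  linarith [re_expect_pmpSigmaSlack_nonneg ω hω h0 s σ τ hστ S Lam hmem κ B hκ hB]

end Sigma

end Summit.Ventures.CertifiedManyBodySolver.Transport

end
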